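import Literature.Probability.RandomPlanarGeometry.HexSAWBrickWallStripFugacityWidthOneExact
import HarnessLib

/-!
# Self-avoiding walks on the two-row honeycomb ladder reverse their direction at most twice

Topic `Literature/Probability/RandomPlanarGeometry` (continues `HexSAWBrickWallStripFugacityWidthOneExact.lean`, Part B: the observables
`LadderPot.colAt / nV / hd / gd` of a walk `p ∈ HexBW.stripPairs 1 n` of the one-cell brick-wall strip `S_1 = ℤ × {0,1}` (rungs at the
even columns), the step lemmas `vert_step`, `horiz_step`, `not_vert_vert`, `run_straight`, and the corridor lemma
`other_site_visited_of_reversal`).  Sources: N. Madras, G. Slade, *The Self-Avoiding Walk* (1993) §1.1 (self-avoidance), §8.2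
(walks in strips, (8.2.1)–(8.2.3)); N. R. Beaton et al., CMP 326 (2014), arXiv:1109.0358v5 §3.2 (p. 10: «n-step walks in a strip of height T», the honeycomb strips `S_T`);
I. G. Enting, I. Jensen, LNP 775 (2009) §7.4.2 Fig. 7.10 (brick-wall form).  The statements below are the STRUCTURE HALF of the
classification of the walks of `S_1` behind the lane's rational walk series `Σ_N C_{1,N}(y,z) xᴺ =
P(x,y,z)/([(1−yx²)(1−zx²) − yzx⁶](1 − yzx⁴)²)` (HOME `FINDING-HEX-S1-WALK-SERIES.md`; its formalisation is the sequel project).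

A RUNG is a vertical step (`vertAt p t = true`); between rungs a walk runs straight (`run_straight`).  The rung at time `t` is a
REVERSAL if the heading after it is opposite to the heading before it; in the observables of the previous file, read two steps later
(the step after a rung is horizontal, `not_vert_vert`): `hd p (t+2) ≠ gd p (t+2)` with `gd p (t+2) = hd p t ≠ 0`.

## Statements (namespace `Literature.Probability.RandomPlanarGeometry.SAW.HexBW.LadderPot`, all PROVED, standard axioms)

* `pref_mem_of_le` (every prefix of a strip walk is a strip walk), `hd_run` (the heading along a straight run is its direction),
  `gd_run` (`gd` is frozen along a run), `nV_mono`, `nV_run`;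
* ★★ **`no_vert_after_reversal`**: if the rung at time `t` is at least the second rung (`2 ≤ nV p (t+1)`) and is a reversal, then NO
  later step is vertical — the walk ends in the corridor;
* ★★ **`length_lt_of_reversal`** (the corridor bound): in that situation the final run is SHORTER than the run before the rung:
  `n − t − 1 ≤ (t − t' − 1) − 1` where `t'` is the previous rung (stated additively: `n + t' + 1 ≤ 2t`);
* ★ **`no_vert_above_initial_run`**: if the FIRST rung (at time `t = a₀ ≥ 1`, after `a₀` horizontal steps) is a reversal, no rung is
  possible during the next `a₀` steps (each would land on the initial run);
* ★★★ **`card_reversals_le_two`**: the set of reversal rungs of any self-avoiding walk of `S_1` has at most two elements (at most the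
  first rung, and at most one later rung, which is then the last).

* ★★ **`length_le_of_second_reversal`**: after a first-rung U-turn that has passed the starting column (`a₁ ≥ a₀ + 1`), a second
  reversal (at the next rung) leaves at most `a₁ − a₀ − 1` steps — the START site is the obstacle (`n ≤ 2a₁ + 1`).

NOT treated here: the converse (every word obeying the bounds is self-avoiding) and the second reversal at a LATER rung after a long
U-turn (covered by `length_lt_of_reversal`) — the series project assembles them.
-/

noncomputable section

open Finset Literature.Probability.LatticeModels Literature.Probability.Percolation SimpleGraph

namespace Literature.Probability.RandomPlanarGeometry.SAW.HexBW

namespace LadderPot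

open WallPot

variable {n : ℕ} {p : Site 2 × (ℕ → Site 2)}

/-! ## §1 Prefixes and observables along a run -/

/-- Iterating the one-step prefix: `pref N (pref M p) = pref N p` for `N ≤ M`. [cite: MadrasSlade1993, §8.2, eq. (8.2.2)] -/
theorem pref_pref {N M : ℕ} (h : N ≤ M) (p : Site 2 × (ℕ → Site 2)) : pref N (pref M p) = pref N p := by
  unfold pref
  simp only [Prod.mk.injEq, true_and]
  funext i
  rw [min_eq_left (le_trans (min_le_right i N) h)]

/-- A strip walk is its own full prefix (walks are frozen after their length). [cite: MadrasSlade1993, §8.2, eq. (8.2.2)] -/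
theorem pref_self {T : ℕ} (hp : p ∈ stripPairs T n) : pref n p = p := by
  obtain ⟨-, hω, -, -⟩ := mem_stripPairs.1 hp
  obtain ⟨-, hend, -, -⟩ := Zd.mem_saws.1 hω
  unfold pref
  ext1
  · rfl
  · funext i
    show p.2 (min i n) = p.2 i
    by_cases hi : i ≤ n
    · rw [min_eq_left hi]
    · rw [min_eq_right (le_of_not_ge hi)]
      exact (hend i (by omega)).symm

/-- **Every prefix of a strip walk is a strip walk.** [cite: MadrasSlade1993, §8.2, eq. (8.2.2)] -/
theorem pref_mem_of_le {T u : ℕ} (hp : p ∈ stripPairs T n) (hu : u ≤ n) : pref u p ∈ stripPairs T u := by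
  obtain ⟨d, rfl⟩ := Nat.exists_eq_add_of_le hu
  induction d generalizing p with
  | zero =>
    rw [Nat.add_zero] at hp
    rw [pref_self hp]
    exact hp
  | succ d ih =>
    rw [← Nat.add_assoc] at hp
    have h1 : pref (u + d) p ∈ stripPairs T (u + d) := pref_mem hp
    have h2 := ih h1 (by omega)
    rwa [pref_pref (by omega)] at h2

/-- Observables of the prefix agree with those of the walk up to the cut. [cite: MadrasSlade1993, §8.2, eq. (8.2.2)] -/
theorem obs_pref {u : ℕ} (p : Site 2 × (ℕ → Site 2)) :
    (∀ i < u, vertAt (pref u p) i = vertAt p i) ∧ nV (pref u p) u = nV p u ∧ hd (pref u p) u = hd p u ∧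
      gd (pref u p) u = gd p u ∧ colAt (pref u p) u = colAt p u :=
  obs_congr fun _ hi => siteAt_pref hi

/-- `nV` is non-decreasing. [cite: EntingJensen2009, §7.4.2, Fig. 7.10] -/
theorem nV_mono (p : Site 2 × (ℕ → Site 2)) {a b : ℕ} (hab : a ≤ b) : nV p a ≤ nV p b := by
  obtain ⟨d, rfl⟩ := Nat.exists_eq_add_of_le hab
  induction d with
  | zero => simp
  | succ d ih =>
    rw [show a + (d + 1) = a + d + 1 by ring, nV_succ]
    have := ih (by omega)
    split_ifs <;> omega

/-- `nV` is constant along a run of horizontal steps. [cite: EntingJensen2009, §7.4.2, Fig. 7.10] -/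
theorem nV_run {t j : ℕ} (hH : ∀ k < j, vertAt p (t + 1 + k) = false) : nV p (t + 1 + j) = nV p (t + 1) := by
  induction j with
  | zero => simp
  | succ j ih =>
    rw [show t + 1 + (j + 1) = t + 1 + j + 1 by ring, nV_succ, hH j (by omega), ih fun k hk => hH k (by omega)]
    simp

/-- `gd` is frozen along a run of horizontal steps. [cite: EntingJensen2009, §7.4.2, Fig. 7.10] -/
theorem gd_run {t j : ℕ} (hH : ∀ k < j, vertAt p (t + 1 + k) = false) : gd p (t + 1 + j) = gd p (t + 1) := by
  induction j with
  | zero => simp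
  | succ j ih =>
    rw [show t + 1 + (j + 1) = t + 1 + j + 1 by ring, gd_succ_of_horiz (hH j (by omega)), ih fun k hk => hH k (by omega)]

/-- **The heading along a straight run is its (constant) direction**: for horizontal steps `t+1, …, t+j` (`j ≥ 1`),
`hd p (t+1+j) = colAt p (t+2) − colAt p (t+1)`. [cite: MadrasSlade1993, §1.1 (no immediate reversal)] -/
theorem hd_run {T : ℕ} (hp : p ∈ stripPairs T n) {t j : ℕ} (htj : t + 1 + j ≤ n) (hj : 1 ≤ j)
    (hH : ∀ k < j, vertAt p (t + 1 + k) = false) : hd p (t + 1 + j) = colAt p (t + 2) - colAt p (t + 1) := by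
  have hr := run_straight hp (i := t + 1) (m := j) htj hj hH
  obtain ⟨-, hall⟩ := hr
  rw [hd_eq_of_run hH hj]
  have h1 := (hall j le_rfl).1
  have h2 := (hall (j - 1) (by omega)).1
  rw [show t + 1 + 1 = t + 2 by ring] at h1 h2
  rw [show t + j = t + 1 + (j - 1) by omega, h1, h2]
  push_cast [Nat.cast_sub hj]
  ring

/-! ## §2 No rung after a reversal at the second or a later rung -/

/-- ★★ **After a reversal at the second or a later rung the walk never takes another rung**: every rung available in the corridor
lands on the run before the previous rung (`other_site_visited_of_reversal`). Formally: if `vertAt p t`, `2 ≤ nV p (t+1)`,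
`t + 2 ≤ n` and `hd p (t+2) ≠ gd p (t+2)`, then all steps after `t` are horizontal.
[cite: MadrasSlade1993, §1.1 (self-avoidance); BeatonBousquetMelouDeGierDuminilCopinGuttmann2014, §3.2 (arXiv v5 p. 10: «n-step walks in a strip of height T»)] -/
theorem no_vert_after_reversal (hp : p ∈ stripPairs 1 n) {t : ℕ} (ht : t + 2 ≤ n) (hv : vertAt p t = true)
    (h2 : 2 ≤ nV p (t + 1)) (hrev : hd p (t + 2) ≠ gd p (t + 2)) :
    ∀ j, t + 1 + j < n → vertAt p (t + 1 + j) = false := by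
  intro j
  induction j using Nat.strong_induction_on with
  | _ j ih =>
    intro hjn
    rcases Nat.eq_zero_or_pos j with rfl | hj
    · -- the step right after a rung is horizontal
      by_contra hc
      have hc' : vertAt p (t + 1) = true := by simpa using hc
      exact not_vert_vert hp (by omega) hv hc'
    · by_contra hc
      have hc' : vertAt p (t + 1 + j) = true := by simpa using hc
      have hH : ∀ k < j, vertAt p (t + 1 + k) = false := fun k hk => ih k hk (by omega)
      -- work in the prefix of length `u = t + 1 + j`
      set u := t + 1 + j with hu
      set q := pref u p with hq
      have hqmem : q ∈ stripPairs 1 u := pref_mem_of_le hp (by omega)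
      obtain ⟨hvq, hnq, hhq, hgq, hcq⟩ := obs_pref (u := u) p
      -- hypotheses of the corridor lemma for `q` at time `u = (u - 1) + 1`
      have hu1 : u = (t + j) + 1 := by omega
      have hHq : vertAt q (t + j) = false := by
        rw [hvq (t + j) (by omega)]
        have := hH (j - 1) (by omega)
        rwa [show t + 1 + (j - 1) = t + j by omega] at this
      have h2q : 2 ≤ nV q ((t + j) + 1) := by
        rw [← hu1, hnq, hu, nV_run hH]; exact h2
      have hrevq : hd q ((t + j) + 1) ≠ gd q ((t + j) + 1) := by
        rw [← hu1, hhq, hgq, hu, hd_run hp (by omega) hj hH, gd_run hH]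
        have e1 : hd p (t + 2) = colAt p (t + 2) - colAt p (t + 1) := by
          have := hd_run hp (t := t) (j := 1) (by omega) le_rfl (fun k hk => by
            have : k = 0 := by omega
            subst this; simpa using hH 0 hj)
          simpa using this
        have e2 : gd p (t + 2) = gd p (t + 1) := by
          have := gd_run (p := p) (t := t) (j := 1) (fun k hk => by
            have : k = 0 := by omega
            subst this; simpa using hH 0 hj)
          simpa using this
        rw [← e1, ← e2]; exact hrev
      have hq' : q ∈ stripPairs 1 ((t + j) + 1) := by rw [← hu1]; exact hqmem
      obtain ⟨m, hm, hm0, hm1⟩ := other_site_visited_of_reversal hq' hHq h2q hrevq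
      rw [← hu1] at hm hm0 hm1
      -- the rung at `u` lands exactly on that visited site
      obtain ⟨c0, c1, -⟩ := vert_step hp hjn hc'
      have hsm : siteAt q m = siteAt p m := siteAt_pref hm
      have hsu : siteAt q u = siteAt p u := siteAt_pref le_rfl
      have he : siteAt p (u + 1) = siteAt p m := by
        rw [site_two_eq_iff, ← hsm]
        unfold colAt at hm0
        rw [hsu] at hm0 hm1
        constructor
        · rw [c0, hm0]
        · rw [c1, hm1]
      have := time_eq_of_siteAt_eq hp (by omega) (by omega) he
      omega

/-! ## §3 The corridor bound -/

/-- ★★ **The corridor bound.** In the situation of `no_vert_after_reversal`, let `t'` be the previous rung (`vertAt p t'`, steps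
`t'+1, …, t−1` horizontal, `t' + 2 ≤ t`).  Then the final run (all `n − t − 1` steps after `t`) is shorter than the run before `t`:
`n − t − 1 ≤ t − t' − 2`, i.e. `n + t' + 1 ≤ 2t`. [cite: MadrasSlade1993, §1.1 (self-avoidance); BeatonBousquetMelouDeGierDuminilCopinGuttmann2014, §3.2 (arXiv v5 p. 10: «n-step walks in a strip of height T»)] -/
theorem length_lt_of_reversal (hp : p ∈ stripPairs 1 n) {t t' : ℕ} (ht : t + 2 ≤ n) (hv : vertAt p t = true)
    (hv' : vertAt p t' = true) (htt : t' + 2 ≤ t) (hB : ∀ k, k + t' + 1 < t → vertAt p (t' + 1 + k) = false)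
    (hrev : hd p (t + 2) ≠ gd p (t + 2)) : n + t' + 1 ≤ 2 * t := by
  -- `nV p (t+1) ≥ 2`: the rungs `t'` and `t`
  have h2 : 2 ≤ nV p (t + 1) := by
    have a : nV p (t' + 1) = nV p t' + 1 := by rw [nV_succ, hv']; simp
    have b : nV p (t + 1) = nV p t + 1 := by rw [nV_succ, hv]; simp
    have c := nV_mono p (show t' + 1 ≤ t by omega)
    omega
  have hA : ∀ j, t + 1 + j < n → vertAt p (t + 1 + j) = false := no_vert_after_reversal hp ht hv h2 hrev
  -- linearise: n = t + 1 + J (J ≥ 1 final steps), t = t' + 1 + L (L ≥ 1 steps of the previous run)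
  obtain ⟨J, hJ⟩ : ∃ J, n = t + 1 + J := ⟨n - t - 1, by omega⟩
  obtain ⟨L, hL⟩ : ∃ L, t = t' + 1 + L := ⟨t - t' - 1, by omega⟩
  have hJ1 : 1 ≤ J := by omega
  have hL1 : 1 ≤ L := by omega
  have runA := run_straight hp (i := t + 1) (m := J) (by omega) hJ1 (fun k hk => hA k (by omega))
  have runB := run_straight hp (i := t' + 1) (m := L) (by omega) hL1 (fun k hk => hB k (by omega))
  obtain ⟨hdA, hAll⟩ := runA
  obtain ⟨hdB, hBll⟩ := runB
  -- headings: after `t` the direction is `dA`, before `t` it was `dB`, and they are opposite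
  have hhd : hd p (t + 2) = colAt p (t + 1 + 1) - colAt p (t + 1) := by
    have := hd_run hp (t := t) (j := 1) (by omega) le_rfl (fun k hk => by
      have hk0 : k = 0 := by omega
      subst hk0; simpa using hA 0 (by omega))
    simpa [show t + 1 + 1 = t + 2 by ring] using this
  have hgd : gd p (t + 2) = colAt p (t' + 1 + 1) - colAt p (t' + 1) := by
    have g1 : gd p (t + 2) = gd p (t + 1) := by
      have := gd_run (p := p) (t := t) (j := 1) (fun k hk => by
        have hk0 : k = 0 := by omega
        subst hk0; simpa using hA 0 (by omega))
      simpa [show t + 1 + 1 = t + 2 by ring] using this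
    rw [g1, gd_succ_of_vert hv]
    -- `hd p t` = direction of the run before `t`
    have := hd_run hp (t := t') (j := L) (by omega) hL1 (fun k hk => hB k (by omega))
    rw [← hL] at this
    simpa [show t' + 1 + 1 = t' + 2 by ring] using this
  -- geometry of the two rungs
  obtain ⟨vt0, vt1, -⟩ := vert_step hp (show t < n by omega) hv
  obtain ⟨vt'0, vt'1, -⟩ := vert_step hp (show t' < n by omega) hv'
  -- if the final run were as long as the previous run, the time `t + 1 + L` would revisit the site of time `t'`
  by_contra hcon
  have hLJ : L ≤ J := by omega
  have hu := hAll L hLJ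
  have hB_t := hBll L le_rfl
  rw [← hL] at hB_t
  have he : siteAt p (t + 1 + L) = siteAt p t' := by
    rw [site_two_eq_iff]
    unfold colAt at *
    have hA1 := (hAll 1 hJ1).1
    have hB1 := (hBll 1 hL1).1
    constructor
    · rcases hdA with h | h <;> rcases hdB with h' | h' <;> simp only [h, h'] at hu hB_t hhd hgd hrev <;> omega
    · have := hu.2; have := hB_t.2; omega
  have := time_eq_of_siteAt_eq hp (by omega) (by omega) he
  omega

/-! ## §4 The first rung: a U-turn above the initial run admits no rung -/

/-- The heading after a run of horizontal steps `i, …, i+j−1` (`j ≥ 1`) is the run's direction `colAt p (i+1) − colAt p i`.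
[cite: MadrasSlade1993, §1.1 (no immediate reversal)] -/
theorem hd_run' {T : ℕ} (hp : p ∈ stripPairs T n) {i j : ℕ} (hij : i + j ≤ n) (hj : 1 ≤ j)
    (hH : ∀ k < j, vertAt p (i + k) = false) : hd p (i + j) = colAt p (i + 1) - colAt p i := by
  obtain ⟨-, hall⟩ := run_straight hp hij hj hH
  obtain ⟨j', rfl⟩ := Nat.exists_eq_add_of_le' hj
  rw [show i + (j' + 1) = i + j' + 1 by ring, hd_succ_of_horiz (hH j' (by omega))]
  have h1 := (hall (j' + 1) le_rfl).1
  have h2 := (hall j' (by omega)).1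
  rw [show i + (j' + 1) = i + j' + 1 by ring] at h1
  rw [h1, h2]
  push_cast
  ring

/-- ★ **A U-turn at the FIRST rung cannot be followed by a rung while the walk is above its initial run**: if the steps `0, …, t−1`
are horizontal (`t ≥ 1`), the step `t` is a rung and the heading reverses across it (`hd p (t+2) ≠ hd p t`), then the steps
`t+1, …, t+k` are horizontal for every `k ≤ t` (a rung at time `t+1+k`, `1 ≤ k ≤ t`, would land on the site of time `t − k`).
[cite: MadrasSlade1993, §1.1 (self-avoidance); BeatonBousquetMelouDeGierDuminilCopinGuttmann2014, §3.2 (arXiv v5 p. 10: «n-step walks in a strip of height T»)] -/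
theorem no_vert_above_initial_run (hp : p ∈ stripPairs 1 n) {t : ℕ} (ht1 : 1 ≤ t) (h0 : ∀ i < t, vertAt p i = false)
    (hv : vertAt p t = true) (ht : t + 2 ≤ n) (hrev : hd p (t + 2) ≠ hd p t) :
    ∀ k, k ≤ t → t + 1 + k < n → vertAt p (t + 1 + k) = false := by
  intro k
  induction k using Nat.strong_induction_on with
  | _ k ih =>
    intro hkt hkn
    rcases Nat.eq_zero_or_pos k with rfl | hk
    · by_contra hc
      have hc' : vertAt p (t + 1) = true := by simpa using hc
      exact not_vert_vert hp (by omega) hv hc'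
    · by_contra hc
      have hc' : vertAt p (t + 1 + k) = true := by simpa using hc
      have hH : ∀ i < k, vertAt p (t + 1 + i) = false := fun i hi => ih i hi (by omega) (by omega)
      -- the initial run and the run after the rung
      obtain ⟨hd0, hrun0⟩ := run_straight hp (i := 0) (m := t) (by omega) ht1 (fun i hi => by simpa using h0 i hi)
      obtain ⟨hd1, hrun1⟩ := run_straight hp (i := t + 1) (m := k) (by omega) hk hH
      -- the two headings are opposite
      have e0 : hd p t = colAt p (0 + 1) - colAt p 0 := by
        have := hd_run' hp (i := 0) (j := t) (by omega) ht1 (fun i hi => by simpa using h0 i hi)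
        simpa using this
      have e1 : hd p (t + 2) = colAt p (t + 1 + 1) - colAt p (t + 1) := by
        have := hd_run' hp (i := t + 1) (j := 1) (by omega) le_rfl (fun i hi => by
          have hi0 : i = 0 := by omega
          subst hi0; exact hH 0 hk)
        simpa [show t + 1 + 1 = t + 2 by ring] using this
      obtain ⟨vt0, vt1, -⟩ := vert_step hp (show t < n by omega) hv
      obtain ⟨c0, c1, -⟩ := vert_step hp hkn hc'
      -- the rung at `t+1+k` lands on the site of time `t − k`
      have hA := hrun1 k le_rfl
      have hB := hrun0 (t - k) (by omega)
      simp only [zero_add] at hB hd0 e0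
      have he : siteAt p (t + 1 + k + 1) = siteAt p (t - k) := by
        rw [site_two_eq_iff]
        unfold colAt at *
        have hBt := hrun0 t le_rfl
        simp only [zero_add] at hBt
        constructor
        · rcases hd0 with h | h <;> rcases hd1 with h' | h' <;> simp only [h, h'] at hA hB hBt e0 e1 hrev <;> omega
        · have := hA.2; have := hB.2; have := (hrun0 t le_rfl).2; simp only [zero_add] at this; omega
      have := time_eq_of_siteAt_eq hp (by omega) (by omega) he
      omega

/-! ## §5 At most two reversals -/

/-- ★★★ **A self-avoiding walk of the one-cell honeycomb strip reverses its direction at most twice**: the set of REVERSAL RUNGS — times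
`t < n` with a vertical step at `t`, `t + 2 ≤ n`, and `hd p (t+2) ≠ gd p (t+2)` (the heading after the rung differs from the heading before
it; a first rung taken before any horizontal step also counts, harmlessly) — has at most two elements: at most the first rung, and at
most one later rung (after which the walk takes no rung at all, `no_vert_after_reversal`).
[cite: MadrasSlade1993, §1.1, §8.2; BeatonBousquetMelouDeGierDuminilCopinGuttmann2014, §3.2 (arXiv v5 p. 10: «n-step walks in a strip of height T»)] -/
theorem card_reversals_le_two (hp : p ∈ stripPairs 1 n) :
    #((Finset.range n).filter fun t => vertAt p t = true ∧ t + 2 ≤ n ∧ hd p (t + 2) ≠ gd p (t + 2)) ≤ 2 := by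
  classical
  set R := (Finset.range n).filter fun t => vertAt p t = true ∧ t + 2 ≤ n ∧ hd p (t + 2) ≠ gd p (t + 2) with hR
  have mem_R : ∀ {t}, t ∈ R ↔ t < n ∧ vertAt p t = true ∧ t + 2 ≤ n ∧ hd p (t + 2) ≠ gd p (t + 2) := fun {t} => by
    rw [hR, Finset.mem_filter, Finset.mem_range]
  -- split by whether the rung is the first one
  set R₁ := R.filter (fun t => nV p (t + 1) ≤ 1) with hR₁
  set R₂ := R.filter (fun t => ¬ nV p (t + 1) ≤ 1) with hR₂
  have hsplit : #R = #R₁ + #R₂ := by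
    rw [hR₁, hR₂]; exact (Finset.card_filter_add_card_filter_not _).symm
  -- a rung at `t` makes `nV p (t+1) = nV p t + 1 ≥ 1`
  have hstep : ∀ t, vertAt p t = true → nV p (t + 1) = nV p t + 1 := fun t ht => by rw [nV_succ, ht]; simp
  have h1 : #R₁ ≤ 1 := by
    refine Finset.card_le_one.2 fun a ha b hb => ?_
    rw [hR₁, Finset.mem_filter, mem_R] at ha hb
    by_contra hab
    rcases lt_or_gt_of_ne hab with h | h
    · have := nV_mono p (show a + 1 ≤ b by omega)
      have := hstep a ha.1.2.1; have := hstep b hb.1.2.1; omega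
    · have := nV_mono p (show b + 1 ≤ a by omega)
      have := hstep a ha.1.2.1; have := hstep b hb.1.2.1; omega
  have h2 : #R₂ ≤ 1 := by
    refine Finset.card_le_one.2 fun a ha b hb => ?_
    rw [hR₂, Finset.mem_filter, mem_R] at ha hb
    by_contra hab
    rcases lt_or_gt_of_ne hab with h | h
    · obtain ⟨⟨-, hva, ha2, hra⟩, hna⟩ := ha
      have := no_vert_after_reversal hp ha2 hva (by omega) hra (b - a - 1) (by omega)
      rw [show a + 1 + (b - a - 1) = b by omega] at this
      rw [this] at hb; exact Bool.false_ne_true hb.1.2.1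
    · obtain ⟨⟨-, hvb, hb2, hrb⟩, hnb⟩ := hb
      have := no_vert_after_reversal hp hb2 hvb (by omega) hrb (a - b - 1) (by omega)
      rw [show b + 1 + (a - b - 1) = a by omega] at this
      rw [this] at ha; exact Bool.false_ne_true ha.1.2.1
  omega

/-- ★★ **The second reversal after a long first-rung U-turn is bounded by the START site.** First rung at `t ≥ 1` after `t`
horizontal steps, reversal at `t`, then `a₁` horizontal steps with `a₁ ≥ t + 1` (the U-turn passes the starting column), a rung at
`t₂ = t + 1 + a₁`, and a reversal at `t₂`: then the final run (no further rung, `no_vert_after_reversal`) has at most `a₁ − t − 1`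
steps, i.e. `n ≤ 2a₁ + 1` — at `a₁ − t` steps it would return to the starting site.
[cite: MadrasSlade1993, §1.1 (self-avoidance); BeatonBousquetMelouDeGierDuminilCopinGuttmann2014, §3.2 (arXiv v5 p. 10: «n-step walks in a strip of height T»)] -/
theorem length_le_of_second_reversal (hp : p ∈ stripPairs 1 n) {t a₁ : ℕ} (ht1 : 1 ≤ t) (h0 : ∀ i < t, vertAt p i = false)
    (hv : vertAt p t = true) (hrev : hd p (t + 2) ≠ hd p t) (ha : t + 1 ≤ a₁) (h1 : ∀ k < a₁, vertAt p (t + 1 + k) = false)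
    (hv2 : vertAt p (t + 1 + a₁) = true) (hn : t + 1 + a₁ + 2 ≤ n)
    (hrev2 : hd p (t + 1 + a₁ + 2) ≠ gd p (t + 1 + a₁ + 2)) : n ≤ 2 * a₁ + 1 := by
  set t₂ := t + 1 + a₁ with ht₂
  -- `nV p (t₂ + 1) = 2`
  have hstep : ∀ s, vertAt p s = true → nV p (s + 1) = nV p s + 1 := fun s hs => by rw [nV_succ, hs]; simp
  have h2 : 2 ≤ nV p (t₂ + 1) := by
    have a := hstep t hv; have b := hstep t₂ hv2
    have c := nV_mono p (show t + 1 ≤ t₂ by omega); omega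
  have hA : ∀ j, t₂ + 1 + j < n → vertAt p (t₂ + 1 + j) = false := no_vert_after_reversal hp hn hv2 h2 hrev2
  -- the three straight runs
  obtain ⟨d0, run0⟩ := run_straight hp (i := 0) (m := t) (by omega) ht1 (fun i hi => by simpa using h0 i hi)
  obtain ⟨d1, run1⟩ := run_straight hp (i := t + 1) (m := a₁) (by omega) (by omega) h1
  obtain ⟨J, hJ⟩ : ∃ J, n = t₂ + 1 + J := ⟨n - t₂ - 1, by omega⟩
  have hJ1 : 1 ≤ J := by omega
  obtain ⟨d2, run2⟩ := run_straight hp (i := t₂ + 1) (m := J) (by omega) hJ1 (fun k hk => hA k (by omega))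
  -- headings: d1 = -d0 (first reversal), d2 = -d1 (second reversal)
  have e0 : hd p t = colAt p (0 + 1) - colAt p 0 := by
    have := hd_run' hp (i := 0) (j := t) (by omega) ht1 (fun i hi => by simpa using h0 i hi)
    simpa using this
  have e1 : hd p (t + 2) = colAt p (t + 1 + 1) - colAt p (t + 1) := by
    have := hd_run' hp (i := t + 1) (j := 1) (by omega) le_rfl (fun i hi => by
      have hi0 : i = 0 := by omega
      subst hi0; exact h1 0 (by omega))
    simpa [show t + 1 + 1 = t + 2 by ring] using this
  have e2 : hd p (t₂ + 2) = colAt p (t₂ + 1 + 1) - colAt p (t₂ + 1) := by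
    have := hd_run' hp (i := t₂ + 1) (j := 1) (by omega) le_rfl (fun i hi => by
      have hi0 : i = 0 := by omega
      subst hi0; exact hA 0 (by omega))
    simpa [show t₂ + 1 + 1 = t₂ + 2 by ring] using this
  have e3 : gd p (t₂ + 2) = hd p (t + 1 + a₁) := by
    have g1 : gd p (t₂ + 2) = gd p (t₂ + 1) := by
      have := gd_run (p := p) (t := t₂) (j := 1) (fun k hk => by
        have hk0 : k = 0 := by omega
        subst hk0; simpa using hA 0 (by omega))
      simpa [show t₂ + 1 + 1 = t₂ + 2 by ring] using this
    rw [g1, gd_succ_of_vert hv2]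
  have e4 : hd p (t + 1 + a₁) = colAt p (t + 1 + 1) - colAt p (t + 1) := hd_run' hp (by omega) (by omega) h1
  rw [show t + 1 + a₁ + 2 = t₂ + 2 by rfl] at hrev2
  -- geometry of the rungs
  obtain ⟨vt0, vt1, -⟩ := vert_step hp (show t < n by omega) hv
  obtain ⟨wt0, wt1, -⟩ := vert_step hp (show t₂ < n by omega) hv2
  -- if the final run had ≥ a₁ − t steps, the time t₂ + 1 + (a₁ − t) ≤ n would revisit the start
  by_contra hcon
  have hL : a₁ - t ≤ J := by omega
  have hu := run2 (a₁ - t) hL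
  have hm1 := run1 a₁ le_rfl
  have hs0 := run0 t le_rfl
  simp only [zero_add] at hs0 d0 e0
  have he : siteAt p (t₂ + 1 + (a₁ - t)) = siteAt p 0 := by
    rw [site_two_eq_iff]
    unfold colAt at *
    have hm1' := hm1.1; have hs0' := hs0.1; have hu' := hu.1
    rw [← ht₂] at hm1'
    constructor
    · rcases d0 with h | h <;> rcases d1 with h' | h' <;> rcases d2 with h'' | h'' <;>
        simp only [h, h', h''] at hu' hm1' hs0' e0 e1 e2 e4 hrev hrev2 e3 <;> push_cast [Nat.cast_sub (show t ≤ a₁ by omega)] at hu' hm1' hs0' ⊢ <;> omega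
    · have r2 := hu.2; have r1 := hm1.2; have r0 := hs0.2
      rw [← ht₂] at r1
      omega
  have := time_eq_of_siteAt_eq hp (by omega) (by omega) he
  omega

end LadderPot

end Literature.Probability.RandomPlanarGeometry.SAW.HexBW
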